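import Mathlib
import HarnessLib
import Summits.ValiantsHypothesis.ValiantsHypothesis.Theorems.MonotoneRestorationMonotoneRestorationQPScanEval

/-! # Route MonotoneRestoration — crux `MonotoneRestorationQP`, line Sketch, stub D′3
(stmt-ValiantsHypothesis-15886)

**Back to templates** (step D′3 of THEOREM δ′ "exchangeable row scans restore").
A row scan on the `n × n` variable matrix has templates `H c d ∈ ℂ[z_0, …, z_{D-1}]` evaluated at
the row power sums `z_d := Σ_j x_{ij}^{d+1}`. If a scalar representation `r ↦ A'(r)` of width `w'`
on the rows `r ∈ ℂ^n` is entrywise a FIXED linear combination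
`A'(r)_{ab} = Σ_{cd} κ a b cd · H c d (p(r))`, `p(r)_d = Σ_j r_j^{d+1}`, and the matrices `A'(r)`
commute pairwise, then the templates `H' a b := Σ_{cd} κ a b cd • H c d` have sparsity `≤ w² T`,
total degree `≤ Eh`, the same values as the linear combination, and their transfer matrices on the
variable matrix COMMUTE as polynomial matrices: a polynomial identity over the infinite field `ℂ`
follows from the identities at all complex points (`MvPolynomial.funext`), and evaluation at a
point `x` turns `H'(p(row_i))` into `A'(r_i)` with `r_i` the `i`-th row of `x` (the composition
`eval x ∘ aeval g = eval (eval x ∘ g)` is `scanEval_eval_aeval` from the landed D′0 module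
`…QPScanEval`, imported).
-/

noncomputable section

-- `Summit.ValiantsHypothesis.ValiantsHypothesis.…` is the tree's mandated namespace (Sub = Summit).
set_option linter.dupNamespace false

namespace Summit.ValiantsHypothesis.ValiantsHypothesis.Theorems

open Matrix

/-- Evaluation of a fixed linear combination of polynomials is the same linear combination of
the values. -/
theorem templateTransport_eval_comb {D : ℕ} {C : Type} [Fintype C] (c : C → ℂ)
    (H : C → MvPolynomial (Fin D) ℂ) (f : Fin D → ℂ) :
    MvPolynomial.eval f (∑ cd : C, c cd • H cd) = ∑ cd : C, c cd * MvPolynomial.eval f (H cd) := by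
  rw [map_sum]
  exact Finset.sum_congr rfl fun cd _ => MvPolynomial.smul_eval _ _ _

/-- Sparsity of a linear combination of `|C|` polynomials with at most `T` monomials each:
at most `|C| * T` monomials. -/
theorem templateTransport_support_card {D T : ℕ} {C : Type} [Fintype C] (c : C → ℂ)
    (H : C → MvPolynomial (Fin D) ℂ) (hT : ∀ cd, (H cd).support.card ≤ T) :
    (∑ cd : C, c cd • H cd).support.card ≤ Fintype.card C * T := by
  classical
  calc (∑ cd : C, c cd • H cd).support.card
      ≤ (Finset.univ.biUnion fun cd : C => (c cd • H cd).support).card :=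
        Finset.card_le_card MvPolynomial.support_sum
    _ ≤ ∑ cd : C, (c cd • H cd).support.card := Finset.card_biUnion_le
    _ ≤ ∑ _cd : C, T := Finset.sum_le_sum fun cd _ =>
        (Finset.card_le_card MvPolynomial.support_smul).trans (hT cd)
    _ = Fintype.card C * T := by rw [Finset.sum_const, Finset.card_univ, smul_eq_mul]

/-- Total degree of a linear combination of polynomials of total degree `≤ Eh` is `≤ Eh`. -/
theorem templateTransport_totalDegree {D Eh : ℕ} {C : Type} [Fintype C] (c : C → ℂ)
    (H : C → MvPolynomial (Fin D) ℂ) (hE : ∀ cd, (H cd).totalDegree ≤ Eh) :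
    (∑ cd : C, c cd • H cd).totalDegree ≤ Eh :=
  MvPolynomial.totalDegree_finsetSum_le fun cd _ =>
    (MvPolynomial.totalDegree_smul_le _ _).trans (hE cd)

/-- **Entry evaluation lemma.** Evaluating, at a point `x` of the `n × n` variable matrix, the
template `Σ_{cd} c cd • H cd` substituted at the power sums of row `i` gives the linear
combination of the values of the `H cd` at the power sums `(Σ_j x (i, j) ^ (d + 1))_d` of the
`i`-th row of `x` (`eval ∘ aeval` is `scanEval_eval_aeval` of the landed D′0 module). -/
theorem templateTransport_eval_entry {n D : ℕ} {C : Type} [Fintype C] (c : C → ℂ)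
    (H : C → MvPolynomial (Fin D) ℂ) (x : Fin n × Fin n → ℂ) (i : Fin n) :
    MvPolynomial.eval x (MvPolynomial.aeval
        (fun d : Fin D => ∑ j : Fin n, (MvPolynomial.X (i, j) : MvPolynomial (Fin n × Fin n) ℂ)
          ^ ((d : ℕ) + 1)) (∑ cd : C, c cd • H cd)) =
      ∑ cd : C, c cd *
        MvPolynomial.eval (fun d : Fin D => ∑ j : Fin n, x (i, j) ^ ((d : ℕ) + 1)) (H cd) := by
  have hg : (fun d : Fin D => MvPolynomial.eval x (∑ j : Fin n,
      (MvPolynomial.X (i, j) : MvPolynomial (Fin n × Fin n) ℂ) ^ ((d : ℕ) + 1))) =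
      fun d : Fin D => ∑ j : Fin n, x (i, j) ^ ((d : ℕ) + 1) := by
    funext d
    simp only [map_sum, map_pow, MvPolynomial.eval_X]
  rw [scanEval_eval_aeval, hg, templateTransport_eval_comb]

/-- **D′3 — BACK TO TEMPLATES.** If a scalar representation `r ↦ A' r` of width `w'` over the
alphabet `ℂ^n` of rows is entrywise a FIXED linear combination of the template values
`H c d (p_1(r),…,p_D(r))` and its matrices commute pairwise on all rows, then the templates
`H' i j := Σ_{cd} κ i j cd • H c d` (sparsity `≤ w² T`, degree `≤ Eh`, values = the same linear
combination of the values of `H`) define transfer matrices on the `n × n` variable matrix that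
COMMUTE as polynomial matrices — a polynomial identity from identities at all complex points
(`MvPolynomial.funext`; evaluation at `x` turns `H'(p(r_i))` into `A'(r_i)`, `r_i` the `i`-th row
of `x`). [folklore] -/
theorem stub_scan_templateTransport (n w w' D T Eh : ℕ) (H : Fin w → Fin w → MvPolynomial (Fin D) ℂ)
    (hT : ∀ a b, (H a b).support.card ≤ T) (hE : ∀ a b, (H a b).totalDegree ≤ Eh)
    (κ : Fin w' → Fin w' → Fin w × Fin w → ℂ)
    (hcomm : ∀ r r' : Fin n → ℂ,
      (Matrix.of fun i j : Fin w' => ∑ cd : Fin w × Fin w, κ i j cd *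
        MvPolynomial.eval (fun d : Fin D => ∑ j : Fin n, r j ^ ((d : ℕ) + 1)) (H cd.1 cd.2)) *
      (Matrix.of fun i j : Fin w' => ∑ cd : Fin w × Fin w, κ i j cd *
        MvPolynomial.eval (fun d : Fin D => ∑ j : Fin n, r' j ^ ((d : ℕ) + 1)) (H cd.1 cd.2)) =
      (Matrix.of fun i j : Fin w' => ∑ cd : Fin w × Fin w, κ i j cd *
        MvPolynomial.eval (fun d : Fin D => ∑ j : Fin n, r' j ^ ((d : ℕ) + 1)) (H cd.1 cd.2)) *
      (Matrix.of fun i j : Fin w' => ∑ cd : Fin w × Fin w, κ i j cd *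
        MvPolynomial.eval (fun d : Fin D => ∑ j : Fin n, r j ^ ((d : ℕ) + 1)) (H cd.1 cd.2)))
    :
    ∃ H' : Fin w' → Fin w' → MvPolynomial (Fin D) ℂ,
      (∀ a b, (H' a b).support.card ≤ w * w * T) ∧ (∀ a b, (H' a b).totalDegree ≤ Eh) ∧
      (∀ i i' : Fin n,
        (Matrix.of fun a b : Fin w' => MvPolynomial.aeval
            (fun d : Fin D => ∑ j : Fin n, (MvPolynomial.X (i, j) : MvPolynomial (Fin n × Fin n) ℂ)
              ^ ((d : ℕ) + 1)) (H' a b)) *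
        (Matrix.of fun a b : Fin w' => MvPolynomial.aeval
            (fun d : Fin D => ∑ j : Fin n, (MvPolynomial.X (i', j) : MvPolynomial (Fin n × Fin n) ℂ)
              ^ ((d : ℕ) + 1)) (H' a b)) =
        (Matrix.of fun a b : Fin w' => MvPolynomial.aeval
            (fun d : Fin D => ∑ j : Fin n, (MvPolynomial.X (i', j) : MvPolynomial (Fin n × Fin n) ℂ)
              ^ ((d : ℕ) + 1)) (H' a b)) *
        (Matrix.of fun a b : Fin w' => MvPolynomial.aeval
            (fun d : Fin D => ∑ j : Fin n, (MvPolynomial.X (i, j) : MvPolynomial (Fin n × Fin n) ℂ)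
              ^ ((d : ℕ) + 1)) (H' a b))) ∧
      (∀ (f : Fin D → ℂ) (a b : Fin w'),
        MvPolynomial.eval f (H' a b) = ∑ cd : Fin w × Fin w, κ a b cd * MvPolynomial.eval f (H cd.1 cd.2)) := by
  set H' : Fin w' → Fin w' → MvPolynomial (Fin D) ℂ :=
    fun a b => ∑ cd : Fin w × Fin w, κ a b cd • H cd.1 cd.2
  -- (4) values of the new templates
  have hval : ∀ (f : Fin D → ℂ) (a b : Fin w'), MvPolynomial.eval f (H' a b) =
      ∑ cd : Fin w × Fin w, κ a b cd * MvPolynomial.eval f (H cd.1 cd.2) := fun f a b =>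
    templateTransport_eval_comb (κ a b) (fun cd : Fin w × Fin w => H cd.1 cd.2) f
  -- entry evaluation: at the point `x`, the `(a, b)` entry of the `i`-th transfer matrix of `H'`
  -- evaluates to the `(a, b)` entry of `A'(r_i)`, `r_i = (x (i, j))_j` the `i`-th row of `x`
  have hentry : ∀ (x : Fin n × Fin n → ℂ) (i : Fin n) (a b : Fin w'),
      MvPolynomial.eval x (MvPolynomial.aeval
        (fun d : Fin D => ∑ j : Fin n, (MvPolynomial.X (i, j) : MvPolynomial (Fin n × Fin n) ℂ)
          ^ ((d : ℕ) + 1)) (H' a b)) =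
      ∑ cd : Fin w × Fin w, κ a b cd *
        MvPolynomial.eval (fun d : Fin D => ∑ j : Fin n, x (i, j) ^ ((d : ℕ) + 1)) (H cd.1 cd.2) :=
    fun x i a b => templateTransport_eval_entry (κ a b) (fun cd : Fin w × Fin w => H cd.1 cd.2) x i
  refine ⟨H', fun a b => ?_, fun a b => ?_, fun i i' => ?_, hval⟩
  · -- (1) sparsity `≤ |Fin w × Fin w| * T = w * w * T`
    have h := templateTransport_support_card (κ a b) (fun cd : Fin w × Fin w => H cd.1 cd.2)
      fun cd => hT cd.1 cd.2
    simpa only [Fintype.card_prod, Fintype.card_fin] using h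
  · -- (2) total degree `≤ Eh`
    exact templateTransport_totalDegree (κ a b) (fun cd : Fin w × Fin w => H cd.1 cd.2)
      fun cd => hE cd.1 cd.2
  · -- (3) commutation as polynomial matrices: entrywise, then pointwise over the infinite
    -- field `ℂ`, where it is the `(a, b)` entry of `hcomm r_i r_{i'}`
    refine Matrix.ext fun a b => MvPolynomial.funext (R := ℂ) fun x => ?_
    have h := congrFun (congrFun (hcomm (fun j => x (i, j)) (fun j => x (i', j))) a) b
    simp only [Matrix.mul_apply, Matrix.of_apply] at h
    simp only [Matrix.mul_apply, Matrix.of_apply, map_sum, map_mul, hentry]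
    exact h

end Summit.ValiantsHypothesis.ValiantsHypothesis.Theorems

end
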